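import Mathlib
import HarnessLib

/-!
# O1 · lens-2's "Selmer solitaire" in graph normal form — the VOCABULARY (word-shapes of stub₂′
# `OnePrimeConnection` (T4), T4′ `Bad1ThreePrimeConnection`, stub₂″ `PivotRebase`)

Cell `b2b-bsdres`, O1 (p = 2) PROVER ORDER v2.8 (ii′) (o1 PLAN §16; "any idle prover-role seat may
start (ii′) today").  This file is the typing aid `HOME/b2b-bsdres-o1-idea-2-g5/lean/O1Stub2Sketch.lean`
of the lens-2 ideation seat (G5.10, sha16 6280d89047ee7c06) carried into the tree VERBATIM (namespace
renamed, docstrings expanded), so that the prover files `X5/SelmerSolitairePivot.lean` (stub₂″),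
`X5/SelmerSolitaireOnePrime.lean` (stub₂′, x11b3-p2 GEN 5) and the T4′ file import ONE vocabulary.
Pure 𝔽₂ linear algebra — NO arithmetic input; the dictionary to the arithmetic
(stub₁′ `selmerSolitaireDictionary`: vertices of `Γ̂` = a finite set `D` of Kolyvagin primes of `𝒫_k`
plus `∞` = the prime `2`; `S` = adjacency; `Core P n` ⟺ `H¹_{𝓕(n)}(ℚ, E[2])` is one-dimensional; a
one-vertex extension = adjoining one more Kolyvagin prime; `𝒳⁰` = the induced cube graph on core
vertices) is NOT in this file and is NOT asserted anywhere in the tree (ROUTES-O1 §lens-2 G5.1–G5.5).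
HONEST FRAMING (cell, verbatim): research route; the statements below are DEFINITIONS of `Prop`s
(nothing asserted); reach-neutral — R1 (`𝒳⁰` connected at 2) closes NO class by itself; nothing booked;
no mark moved; O1 OPEN.  Definitions only (word-shapes) + one sanity `example`; no named fact.

Contents (all `def`, bodies verbatim from the sketch): `V s` (vertices `D ⊔ {∞}`), `Position s`
(a simple graph on `D ⊔ {∞}` as a symmetric zero-diagonal adjacency matrix over `𝔽₂`), `plus` (`n⁺`),
`Core` (`det Ŝ[n⁺] = 1`, T3 (i)), `oldV`, `lift`, `withNew`, `Extends` (one-vertex extension = a MOVE),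
`CubeAdj`, `Connected` (`𝒳⁰`), `OnePrimeConnection` (stub₂′ = T4), `Bad1Consistent`,
`AdmissibleExtends`, `Bad1ThreePrimeConnection` (T4′), `PivotRebase` (stub₂″).

References: lens-2 GEN 5, ROUTES-O1 §lens-2 G5.2 (normal form T3), G5.3 (T1, T2, T4), G5.9 (T4′),
G5.10 (this vocabulary); B. Mazur, K. Rubin, *Kolyvagin systems*, Mem. AMS 799 (2004), §4.3 (the graph
`𝒳⁰`); A. Bouchet, *Representability of Δ-matroids* (1988) (principal pivoting over `𝔽₂`).
[cite: MazurRubin2004, §4.3]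
-/

namespace Summit.BirchSwinnertonDyer.Rank1Residual.X5.SelmerSolitaire

open Finset

/-- Vertices of `Γ̂` on `D ⊔ {∞}`: `none` = `∞` (the prime `2`), `some i` = the `i`-th prime of `D`
(`|D| = s`). [cite: MazurRubin2004, §4.3] -/
abbrev V (s : ℕ) := Option (Fin s)

/-- A position in T3 normal form = a simple graph on `D ⊔ {∞}`, as its adjacency matrix over `𝔽₂`
(symmetric, zero diagonal). (lens-2 G5.2, T3.) [cite: MazurRubin2004, §4.3] -/
structure Position (s : ℕ) where
  /-- the adjacency matrix `Ŝ` -/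
  S : Matrix (V s) (V s) (ZMod 2)
  /-- `Ŝ` is symmetric -/
  symm : S.IsSymm
  /-- `Ŝ` has zero diagonal (no loops) -/
  loopless : ∀ v, S v v = 0

variable {s : ℕ}

/-- `n⁺ = n` if `|n|` is even, `n ∪ {∞}` if `|n|` is odd. (lens-2 G5.2, T3 (i).) [cite: MazurRubin2004, §4.3] -/
def plus (n : Finset (Fin s)) : Finset (V s) :=
  if Even n.card then n.map Function.Embedding.some else insert none (n.map Function.Embedding.some)

/-- `core(n) ⟺ det Ŝ[n⁺] = 1` over `𝔽₂` (T3 (i): odd number of perfect matchings); `Core P ∅` holds for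
every position. [cite: MazurRubin2004, §4.3 (core vertices)] -/
def Core (P : Position s) (n : Finset (Fin s)) : Prop :=
  (P.S.submatrix (fun x : ↥(plus n) => (x : V s)) (fun x : ↥(plus n) => (x : V s))).det = 1

/-- The old vertices inside a one-vertex extension (the new vertex is `some (Fin.last s)`). [folklore] -/
def oldV : V s → V (s + 1) := Option.map Fin.castSucc

/-- Lift a vertex of the cube on `D` to the cube on `D ∪ {q}`. [folklore] -/
def lift (n : Finset (Fin s)) : Finset (Fin (s + 1)) := n.map Fin.castSuccEmb

/-- The vertex `n ∪ {q}` of the extended cube, `q` the new prime. [folklore] -/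
def withNew (n : Finset (Fin s)) : Finset (Fin (s + 1)) := insert (Fin.last s) (lift n)

/-- `P'` is a one-vertex extension of `P` (a MOVE: adjoin one Kolyvagin prime, arbitrary
neighbourhood). (lens-2 G5.2.) [cite: MazurRubin2004, §4.3] -/
def Extends (P : Position s) (P' : Position (s + 1)) : Prop :=
  ∀ x y : V s, P'.S (oldV x) (oldV y) = P.S x y

/-- Edges of the cube restricted to core vertices. (lens-2 G5.3, T2.) [cite: MazurRubin2004, §4.3] -/
def CubeAdj (P : Position s) (n m : Finset (Fin s)) : Prop :=
  Core P n ∧ Core P m ∧ ((n ⊆ m ∧ (m \ n).card = 1) ∨ (m ⊆ n ∧ (n \ m).card = 1))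

/-- Connectivity in `𝒳⁰(P)`. [cite: MazurRubin2004, §4.3] -/
def Connected (P : Position s) (n m : Finset (Fin s)) : Prop :=
  Relation.ReflTransGen (CubeAdj P) n m

/-- stub₂′ = T4 (ONE-PRIME CONNECTION), pure form: for every graph on `D ⊔ {∞}` and every core `B ⊆ D`
there are a one-vertex extension (new vertex `q`) and an ordering `b₁,…,b_d` of `B` such that
`{q}, {b₁,q}, …, B ∪ {q}` are all core — hence `∅ — q — b₁q — … — Bq — B` is a path in `𝒳⁰` of the
extension. (lens-2 G5.3 T4; a `Prop`, nothing asserted here.) [cite: MazurRubin2004, §4.3] -/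
def OnePrimeConnection : Prop :=
  ∀ (s : ℕ) (P : Position s) (B : Finset (Fin s)), Core P B →
    ∃ (P' : Position (s + 1)) (l : List (Fin s)),
      Extends P P' ∧ l.Nodup ∧ l.toFinset = B ∧
      ∀ i ≤ l.length, Core P' (withNew (l.take i).toFinset)

/-- BAD₁ decoration (T3 (ii)): the distinguished class `c₀` has `z(c₀) = 𝟙_A`, `λ`-coefficient `ε₀`, and
its `u`-coordinates force `S·𝟙_A + ε₀ σ = 𝟙_{D∖A}` (`σ = N(∞)`). (lens-2 G5.9.) [cite: MazurRubin2004, §4.3] -/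
def Bad1Consistent (P : Position s) (A : Finset (Fin s)) (ε₀ : ZMod 2) : Prop :=
  ∀ v : Fin s, (∑ a ∈ A, P.S (some v) (some a)) + ε₀ * P.S (some v) none = if v ∈ A then 0 else 1

/-- An ADMISSIBLE move on a BAD₁ row: the new vertex `q`'s neighbourhood `N` has `ψ(c₀) = 1`, i.e.
`[∞ ∈ N]·ε₀ + |N ∩ A| ≡ 1 (mod 2)`; the decoration is inherited as `(lift A, ε₀)`. (lens-2 G5.9.)
[cite: MazurRubin2004, §4.3] -/
def AdmissibleExtends (P : Position s) (A : Finset (Fin s)) (ε₀ : ZMod 2) (P' : Position (s + 1)) :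
    Prop :=
  Extends P P' ∧
    P'.S (some (Fin.last s)) none * ε₀ + (∑ a ∈ A, P'.S (some (Fin.last s)) (some (Fin.castSucc a))) = 1

/-- T4′ (BAD₁ CLOSURE), pure form: on a BAD₁-decorated position, `∅` and any core `B` become connected
in `𝒳⁰` after three successive admissible one-vertex extensions (three always suffice; fewer are padded
by dummy admissible moves, which exist). (lens-2 G5.9; a `Prop`, nothing asserted here.)
[cite: MazurRubin2004, §4.3] -/
def Bad1ThreePrimeConnection : Prop :=
  ∀ (s : ℕ) (P : Position s) (A : Finset (Fin s)) (ε₀ : ZMod 2) (B : Finset (Fin s)),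
    Bad1Consistent P A ε₀ → Core P B →
    ∃ (P₁ : Position (s + 1)) (P₂ : Position (s + 2)) (P₃ : Position (s + 3)),
      AdmissibleExtends P A ε₀ P₁ ∧ AdmissibleExtends P₁ (lift A) ε₀ P₂ ∧
        AdmissibleExtends P₂ (lift (lift A)) ε₀ P₃ ∧ Connected P₃ ∅ (lift (lift (lift B)))

/-- stub₂″ (needed to move the base in the proof of T4′ from T4): principal pivoting at a core vertex
`X` re-bases the position — the cores of the pivot are the translates `n ∆ X` (Tucker/Bouchet
principal pivot transform over `𝔽₂`). (lens-2 G5.10; a `Prop`, proved in `X5/SelmerSolitairePivot.lean`.)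
[cite: MazurRubin2004, §4.3] -/
def PivotRebase : Prop :=
  ∀ (s : ℕ) (P : Position s) (X : Finset (Fin s)), Core P X →
    ∃ P' : Position s, ∀ n : Finset (Fin s), Core P' n ↔ Core P (symmDiff n X)

/-- Sanity: the base vertex is always core (`det` of the empty matrix). [folklore] -/
example (P : Position s) : Core P ∅ := by
  unfold Core
  have h : plus (∅ : Finset (Fin s)) = ∅ := by simp [plus]
  haveI : IsEmpty ↥(plus (∅ : Finset (Fin s))) := by rw [h]; infer_instance
  exact Matrix.det_isEmpty

end Summit.BirchSwinnertonDyer.Rank1Residual.X5.SelmerSolitaire
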